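import Literature.NumberTheory.Sieve.AsymptoticSieveForPrimesTheorem2LevelEventually
import Literature.NumberTheory.Sieve.AsymptoticSieveForPrimesRoughWeakAssembly
import HarnessLib

/-!
# Asymptotic sieve for primes: Theorem 2 with (B*) (= Theorem 3 = [FriedlanderIwaniecAnnals1998] Proposition 2.1), proved

Topic `Literature/NumberTheory/Sieve` (trunk T-SIEVE), the closing file of the series `…Theorem2*`.
Sources: J. Friedlander, H. Iwaniec, *Asymptotic sieve for primes*, Ann. of Math. 148 (1998)
1041–1065 [FriedlanderIwaniecASP1998] (= arXiv:math/9811186), §9 Theorem 2 (pp. 1058–1063) and §10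
Theorem 3; J. Friedlander, H. Iwaniec, *The polynomial `X² + Y⁴` captures its primes*, ibid. 945–1040
[FriedlanderIwaniecAnnals1998], §2 Proposition 2.1 ("a result of [FI3] in a form which is suitable for
the proof of the main theorem": hypotheses (2.1)–(2.15), conclusion (2.16)–(2.17)).

* `SieveSequence.FI1998SieveHypotheses.moebiusSq_size` — (9.12)/(9.14): under (2.1)–(2.15),
  `Ã(x) ≥ (G/2) A(x)` and `|Ã(x) - G A(x)| ≤ 2A(x)/log x` for large `x` (`G = ∏_p (1 - g(p²))`);
* `SieveSequence.FI1998SieveHypotheses.moebiusSq_core` — `ã = μ²a` satisfies the hypotheses of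
  Theorem 1 that do not involve the bilinear form (`FIAsymptoticSieveHypothesesCore`: `size_eq`, (1.4),
  (1.6), (1.8), (1.9), (1.16), (R1), (R) at saving `(log x)^{-2^{22}}`), FI p. 1062: "This completes the
  proof that `𝒜̃` satisfies all the hypotheses of Theorem 1";
* `SieveSequence.FI1998SieveHypotheses.moebiusSq_bilinear` — (B*) for `ã` with saving `(log x)^{-2^{22}}`
  from (2.11) for `a` (`B*(ã) ≤ B_Π(a) ≤ A(x)(log x)^{-2^{26}} ≤ Ã(x)(log x)^{-2^{22}}`);
* `fi_asymptotic_sieve_primes_theorem2_loglog` — **[FriedlanderIwaniecAnnals1998] Proposition 2.1 /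
  [FriedlanderIwaniecASP1998] Theorems 2–3 in the regime `δ = (log x)^α`, `Δ = x^θ` (`α > 0`,
  `0 < θ < 1/3`)**: for EVERY sifted sequence (no restriction on the support) satisfying (2.1)–(2.15)
  (`SieveSequence.FI1998SieveHypotheses`) and with sieve constant `H` (`HasDensityConstant`),
  `S(x) - H A(x) = O(H A(x) log log x / log x)`. Proof: Theorem 1 with (B*) at saving `(log x)^{-2^{22}}`
  (`fi_asymptotic_sieve_primes_roughWeak_loglog`, PROVED in the tree) applied to `ã` with `H̃ = H/G`
  ((9.13)), and the transfer `S̃ = S`, `H̃ Ã(x) = H A(x)(1 + O(1/log x))` ((9.14)).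

This is the statement of the named fact `Literature.NumberTheory.Sieve.FriedlanderIwaniec1998_prop21`
(`FriedlanderIwaniecPrimes`), discharged in the sibling `FriedlanderIwaniecPrimesProp21Holds`.

## References

* J. Friedlander, H. Iwaniec, *Asymptotic sieve for primes*, Ann. of Math. 148 (1998), 1041–1065,
  §9 Theorem 2, (9.12)–(9.14); §10 Theorem 3. [cite: FriedlanderIwaniecASP1998, §9 Theorem 2 and §10 Theorem 3]
* J. Friedlander, H. Iwaniec, *The polynomial `X² + Y⁴` captures its primes*, Ann. of Math. 148
  (1998), 945–1040, Proposition 2.1, (2.16)–(2.17). [cite: FriedlanderIwaniecAnnals1998, Proposition 2.1]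

## Mathlib / tree search

Tree: `fi_asymptotic_sieve_primes_roughWeak_loglog` (`…RoughWeakAssembly`), `FI1998SieveHypotheses`
(`FriedlanderIwaniecPrimes`), `FIAsymptoticSieveHypothesesCore` (`…Rough`), the series `…Theorem2*`.
`lean search 'theorem2_loglog'`: nothing before this file.
-/

noncomputable section

open Filter Finset Real Asymptotics
open scoped ArithmeticFunction.sigma Topology

namespace Literature.NumberTheory.Sieve

open FriedlanderIwaniecPrimesSquarefree FriedlanderIwaniecPrimes

namespace SieveSequence

variable {A : SieveSequence} {D P : ℝ → ℝ} {α θ : ℝ}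

/-- **(9.12)/(9.14) for a general sequence**: under (2.1)–(2.15), for all large `x`,
`(G/2) A(x) ≤ Ã(x)` and `|Ã(x) - G A(x)| ≤ 2 A(x)/log x`, `G = ∏_p (1 - g(p²)) > 0`.
[cite: FriedlanderIwaniecASP1998, (9.12)] -/
theorem FI1998SieveHypotheses.moebiusSq_size
    (hhyp : A.FI1998SieveHypotheses D (fun x => Real.log x ^ α) (fun x => x ^ θ) P) :
    ∀ᶠ x : ℝ in atTop, sqConst A.density / 2 * A.size x ≤ A.moebiusSq.size x ∧
      |A.moebiusSq.size x - sqConst A.density * A.size x| ≤ 2 * A.size x / Real.log x := by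
  obtain ⟨hsize, -, ⟨c₂, hc₂, h22⟩, h24, ⟨K, h2526⟩, ⟨c, K₉, h27⟩, ⟨K₈, h28⟩, hpar, h29, -⟩ := hhyp
  have h26 : ∀ p : ℕ, p.Prime → A.density (p ^ 2) ≤ K / (p : ℝ) ^ 2 := fun p hp => (h2526 p hp).2
  have hK := hyp26_const_nonneg h24 h26
  set G := sqConst A.density with hG
  have hG0 : 0 < G := sqConst_pos h24 h26
  have hR1 : ∀ᶠ x : ℝ in atTop, x ^ (2 / 3 : ℝ) < D x ∧ D x < x := hpar.mono fun x hx => ⟨hx.1, hx.2.1⟩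
  have hlev := A.moebiusSq_level_eventually D hsize hc₂ h22 h24 h26 h27 h28 hR1 h29
  have hKx : ∀ᶠ x : ℝ in atTop, 2 * K * Real.log x ≤ x := by
    have h := Real.isLittleO_log_id_atTop.bound (show (0 : ℝ) < 1 / (2 * K + 1) by positivity)
    filter_upwards [h, eventually_ge_atTop (1 : ℝ)] with x hx hx1
    rw [id, Real.norm_of_nonneg (Real.log_nonneg hx1), Real.norm_of_nonneg (by linarith), one_div,
      le_inv_mul_iff₀ (by positivity)] at hx
    nlinarith [Real.log_nonneg hx1]
  filter_upwards [hlev, hKx, eventually_ge_atTop (2 : ℝ),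
    Real.tendsto_log_atTop.eventually_ge_atTop (2 / G + 1)] with x hlevx hKx hx2 hℒG
  have hx0 : 0 < x := by linarith
  set ℒ := Real.log x with hℒ
  have h2G : 0 < 2 / G := by positivity
  have hℒ1 : 1 < ℒ := by linarith
  have hℒ0 : 0 < ℒ := by linarith
  have hA0 : 0 ≤ A.size x := by rw [hsize]; exact A.congrSum_nonneg 1 x
  set X := ⌊x⌋₊ with hX
  have hX1 : 1 ≤ X := Nat.le_floor (by norm_num; linarith)
  have hXx : x / 2 ≤ X := by have := Nat.lt_floor_add_one x; rw [← hX] at this; linarith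
  have hX0 : (0 : ℝ) < X := by exact_mod_cast (by omega : 0 < X)
  obtain ⟨-, h2⟩ := hlevx x le_rfl
  obtain ⟨hP0, hP1⟩ := sqProd_sub_sqConst_le h24 h26 hX1 (g := A.density)
  rw [← hG] at hP0 hP1
  -- `1/ℒ^{2^22+2} ≤ 1/ℒ ≤ G/2`
  have hpow : A.size x / ℒ ^ (2 ^ 22 + 2) ≤ A.size x / ℒ :=
    div_le_div_of_nonneg_left hA0 hℒ0 (by
      calc ℒ = ℒ ^ 1 := (pow_one ℒ).symm
        _ ≤ ℒ ^ (2 ^ 22 + 2) := pow_le_pow_right₀ hℒ1.le (by norm_num))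
  have h1ℒ : A.size x / ℒ ≤ G / 2 * A.size x := by
    rw [div_le_iff₀ hℒ0]
    have : 1 ≤ G / 2 * ℒ := by
      have h : 2 / G ≤ ℒ := by linarith
      have := (div_le_iff₀ hG0).mp h
      linarith
    nlinarith
  -- `K/X ≤ 1/ℒ`
  have hKX : K / X * A.size x ≤ A.size x / ℒ := by
    rw [div_mul_eq_mul_div, div_le_div_iff₀ hX0 hℒ0]
    have : K * ℒ ≤ X := by linarith
    nlinarith
  have habs := abs_le.mp h2
  constructor
  · -- lower bound
    have : sqProd A.density X * A.size x ≥ G * A.size x := by nlinarith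
    nlinarith [habs.1]
  · -- `|Ã - G A| ≤ |Ã - G_X A| + (G_X - G) A`
    calc |A.moebiusSq.size x - G * A.size x|
        = |(A.moebiusSq.size x - sqProd A.density X * A.size x) + (sqProd A.density X - G) * A.size x| := by
          ring_nf
      _ ≤ |A.moebiusSq.size x - sqProd A.density X * A.size x| + |(sqProd A.density X - G) * A.size x| :=
          abs_add_le _ _
      _ ≤ A.size x / ℒ + A.size x / ℒ := by
          refine add_le_add (h2.trans hpow) ?_
          rw [abs_of_nonneg (mul_nonneg hP0 hA0)]
          exact (mul_le_mul_of_nonneg_right hP1 hA0).trans hKX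
      _ = 2 * A.size x / ℒ := by ring

/-- **`ã` satisfies the (B)-free hypotheses of Theorem 1** (FI p. 1062: "This completes the proof that
`𝒜̃` satisfies all the hypotheses of Theorem 1"): `size_eq`, (1.4), (1.6), (1.8), (1.9), (1.16), (R1) and
(R) with level `D` and saving `(log x)^{-2^{22}}`, from (2.1)–(2.15) for `a`.
[cite: FriedlanderIwaniecASP1998, §9 pp. 1060-1062] -/
theorem FI1998SieveHypotheses.moebiusSq_core
    (hhyp : A.FI1998SieveHypotheses D (fun x => Real.log x ^ α) (fun x => x ^ θ) P) :
    A.moebiusSq.FIAsymptoticSieveHypothesesCore D := by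
  have hsz := hhyp.moebiusSq_size
  obtain ⟨hsize, ⟨c₁, hc₁, h21⟩, ⟨c₂, hc₂, h22⟩, h24, ⟨K, h2526⟩, ⟨c, K₉, h27⟩, ⟨K₈, h28⟩, hpar, h29, -⟩ :=
    hhyp
  have h25 : ∀ p : ℕ, p.Prime → A.density p ≤ K / p := fun p hp => (h2526 p hp).1
  have h26 : ∀ p : ℕ, p.Prime → A.density (p ^ 2) ≤ K / (p : ℝ) ^ 2 := fun p hp => (h2526 p hp).2
  set G := sqConst A.density with hG
  have hG0 : 0 < G := sqConst_pos h24 h26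
  have hR1 : ∀ᶠ x : ℝ in atTop, x ^ (2 / 3 : ℝ) < D x ∧ D x < x := hpar.mono fun x hx => ⟨hx.1, hx.2.1⟩
  have hlev := A.moebiusSq_level_eventually D hsize hc₂ h22 h24 h26 h27 h28 hR1 h29
  have hAle : ∀ x, A.moebiusSq.size x ≤ A.size x := fun x => by
    rw [hsize]; exact (A.moebiusSq_size_nonneg_le x).2
  have hA0 : ∀ x, 0 ≤ A.size x := fun x => by rw [hsize]; exact A.congrSum_nonneg 1 x
  set C₀ : ℝ := 2 * Real.exp (|c| + |K₉| / Real.log 2 ^ 10) with hC₀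
  have hC₀0 : 0 < C₀ := by positivity
  refine ⟨A.moebiusSq_size_eq, ?_, ?_, ?_, ?_, fun n hn => A.moebiusSq_a_of_not_squarefree hn, hR1, ?_⟩
  · -- (1.4)
    refine ⟨c₁ * (G / 2), by positivity, ?_⟩
    filter_upwards [h21, hsz] with x h21x hszx
    calc c₁ * (G / 2) * A.moebiusSq.size (Real.sqrt x) * Real.log x ^ 2
        ≤ c₁ * (G / 2) * A.size (Real.sqrt x) * Real.log x ^ 2 := by
          gcongr
          exact hAle _
      _ = G / 2 * (c₁ * A.size (Real.sqrt x) * Real.log x ^ 2) := by ring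
      _ ≤ G / 2 * A.size x := mul_le_mul_of_nonneg_left h21x (by positivity)
      _ ≤ A.moebiusSq.size x := hszx.1
  · -- (1.6)
    refine ⟨max K₈ 0 * (2 / G), ?_⟩
    filter_upwards [h28, hsz] with x h28x hszx d hd hdx
    have hτ : 0 ≤ (σ 0 d : ℝ) ^ 8 / d := by positivity
    calc A.moebiusSq.congrSum d x ≤ A.congrSum d x := A.moebiusSq_congrSum_le d x
      _ ≤ K₈ * (σ 0 d : ℝ) ^ 8 / d * A.size x := h28x d hd hdx
      _ ≤ max K₈ 0 * (σ 0 d : ℝ) ^ 8 / d * A.size x := by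
          gcongr
          · exact hA0 x
          · exact le_max_left _ _
      _ ≤ max K₈ 0 * (σ 0 d : ℝ) ^ 8 / d * (2 / G * A.moebiusSq.size x) := by
          refine mul_le_mul_of_nonneg_left ?_ (by positivity)
          rw [← div_le_iff₀' (by positivity)]
          calc A.size x / (2 / G) = G / 2 * A.size x := by field_simp
            _ ≤ A.moebiusSq.size x := hszx.1
      _ = max K₈ 0 * (2 / G) * (σ 0 d : ℝ) ^ 8 / d * A.moebiusSq.size x := by ring
  · -- (1.8)
    exact ⟨K, A.moebiusSq_hyp18 h24 h25⟩
  · -- (1.9)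
    exact A.moebiusSq_hyp19 h24 h26 h27
  · -- (R) with saving `(log x)^{-2^22}`
    filter_upwards [hlev, hsz, Real.tendsto_log_atTop.eventually_ge_atTop (C₀ * (2 / G)),
      eventually_gt_atTop (1 : ℝ)] with x hlevx hszx hℒ hx1 t htx
    have hℒ0 : 0 < Real.log x := Real.log_pos hx1
    rw [fiLogSaving]
    calc ∑ d ∈ (Icc 1 ⌊D x⌋₊).filter Squarefree, |A.moebiusSq.remainder d t|
        ≤ C₀ * A.size x / Real.log x ^ (2 ^ 22 + 1) := (hlevx t htx).1
      _ ≤ C₀ * (2 / G * A.moebiusSq.size x) / Real.log x ^ (2 ^ 22 + 1) := by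
          gcongr
          rw [← div_le_iff₀' (by positivity)]
          calc A.size x / (2 / G) = G / 2 * A.size x := by field_simp
            _ ≤ A.moebiusSq.size x := hszx.1
      _ = (C₀ * (2 / G)) * A.moebiusSq.size x / (Real.log x ^ (2 ^ 22) * Real.log x) := by
          rw [pow_succ]; ring
      _ ≤ Real.log x * A.moebiusSq.size x / (Real.log x ^ (2 ^ 22) * Real.log x) := by
          gcongr
          exact (A.moebiusSq_size_nonneg_le x).1
      _ = A.moebiusSq.size x / Real.log x ^ (2 ^ 22) := by
          field_simp

/-- **(B*) for `ã` at saving `(log x)^{-2^{22}}`** from (2.11) for `a`: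
`B*(ã; x,N,C,P) ≤ B_Π(a; x,N,C,P) ≤ A(x)(log x)^{-2^{26}} ≤ Ã(x)(log x)^{-2^{22}}` in the ranges (2.13)–(2.14),
for large `x`. [cite: FriedlanderIwaniecASP1998, §9 p. 1061 and §10] -/
theorem FI1998SieveHypotheses.moebiusSq_bilinear
    (hhyp : A.FI1998SieveHypotheses D (fun x => Real.log x ^ α) (fun x => x ^ θ) P) :
    ∀ᶠ x : ℝ in atTop, ∀ N : ℝ, Real.sqrt (D x) / x ^ θ < N → N < Real.sqrt x / Real.log x ^ α →
      ∀ C : ℝ, 1 ≤ C → C ≤ x / D x →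
        A.moebiusSq.fiBilinearRough x N C (P x) ≤ A.moebiusSq.size x / Real.log x ^ fiLogSaving := by
  have hsz := hhyp.moebiusSq_size
  obtain ⟨hsize, -, -, h24, ⟨K, h2526⟩, -, -, -, -, h211⟩ := hhyp
  have h26 : ∀ p : ℕ, p.Prime → A.density (p ^ 2) ≤ K / (p : ℝ) ^ 2 := fun p hp => (h2526 p hp).2
  set G := sqConst A.density with hG
  have hG0 : 0 < G := sqConst_pos h24 h26
  filter_upwards [h211, hsz, Real.tendsto_log_atTop.eventually_ge_atTop (2 / G), eventually_gt_atTop (1 : ℝ)]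
    with x h211x hszx hℒ hx1 N hN1 hN2 C hC1 hC2
  have hℒ0 : 0 < Real.log x := Real.log_pos hx1
  have hℒ1 : 1 ≤ Real.log x := by
    have : 1 ≤ 2 / G := by
      rw [le_div_iff₀ hG0]; linarith [sqConst_le_one h24 (g := A.density)]
    linarith
  rw [fiLogSaving]
  calc A.moebiusSq.fiBilinearRough x N C (P x) ≤ A.fiBilinearPi x N C (P x) :=
        A.moebiusSq_fiBilinearRough_le_fiBilinearPi x N C (P x)
    _ ≤ A.size x / Real.log x ^ (2 ^ 26 : ℕ) := h211x C hC1 hC2 N hN1 hN2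
    _ ≤ (2 / G * A.moebiusSq.size x) / Real.log x ^ (2 ^ 26 : ℕ) := by
        gcongr
        rw [← div_le_iff₀' (by positivity)]
        calc A.size x / (2 / G) = G / 2 * A.size x := by field_simp
          _ ≤ A.moebiusSq.size x := hszx.1
    _ ≤ (Real.log x * A.moebiusSq.size x) / Real.log x ^ (2 ^ 26 : ℕ) := by
        gcongr
        exact (A.moebiusSq_size_nonneg_le x).1
    _ ≤ (Real.log x * A.moebiusSq.size x) / (Real.log x ^ (2 ^ 22 : ℕ) * Real.log x) := by
        refine div_le_div_of_nonneg_left (mul_nonneg hℒ0.le (A.moebiusSq_size_nonneg_le x).1)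
          (by positivity) ?_
        calc Real.log x ^ (2 ^ 22 : ℕ) * Real.log x = Real.log x ^ (2 ^ 22 + 1 : ℕ) := (pow_succ _ _).symm
          _ ≤ Real.log x ^ (2 ^ 26 : ℕ) := pow_le_pow_right₀ hℒ1 (by norm_num)
    _ = A.moebiusSq.size x / Real.log x ^ (2 ^ 22 : ℕ) := by
        field_simp

end SieveSequence

/-- **Friedlander–Iwaniec, [FriedlanderIwaniecAnnals1998] Proposition 2.1 = [FriedlanderIwaniecASP1998]
Theorems 2–3, in the regime `δ = (log x)^α`, `Δ = x^θ` (`α > 0`, `0 < θ < 1/3`), PROVED.** Let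
`A = (a_n)`, `a_n ≥ 0` (arbitrary support) satisfy (2.1)–(2.15) (`SieveSequence.FI1998SieveHypotheses`)
and let `H = ∏_p (1 - g(p))(1 - 1/p)⁻¹` (`HasDensityConstant`). Then
`∑_{p≤x} a_p log p - H A(x) = O(H A(x) log log x / log x)` ((2.16) with `log δ/log Δ ≍ log log x/log x`).
Proof (FI §9): apply Theorem 1 with (B*) — here `fi_asymptotic_sieve_primes_roughWeak_loglog`, the
version at saving `(log x)^{-2^{22}}` — to `ã = μ²a` with `H̃ = H/G`, `G = ∏_p(1 - g(p²))`
(`moebiusSq_core`, `moebiusSq_bilinear`, `hasDensityConstant_moebiusSq`), and transfer through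
`S̃(x) = S(x)` and `H̃ Ã(x) = H A(x)(1 + O(1/log x))` ((9.12)–(9.14), `moebiusSq_size`).
[cite: FriedlanderIwaniecAnnals1998, Proposition 2.1] -/
theorem fi_asymptotic_sieve_primes_theorem2_loglog (A : SieveSequence) (D P : ℝ → ℝ) (α θ H : ℝ)
    (hα : 0 < α) (hθ : 0 < θ) (hθ3 : θ < 1 / 3)
    (hhyp : A.FI1998SieveHypotheses D (fun x => Real.log x ^ α) (fun x => x ^ θ) P)
    (hH : A.HasDensityConstant H) :
    (fun x : ℝ => (∑ p ∈ Nat.primesLE ⌊x⌋₊, A.a p * Real.log p) - H * A.size x) =O[atTop]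
      fun x : ℝ => H * A.size x * (Real.log (Real.log x) / Real.log x) := by
  have hcore := hhyp.moebiusSq_core
  have hB := hhyp.moebiusSq_bilinear
  have hsz := hhyp.moebiusSq_size
  obtain ⟨hsize, -, -, h24, ⟨K, h2526⟩, -, -, hpar, -, -⟩ := hhyp
  have h26 : ∀ p : ℕ, p.Prime → A.density (p ^ 2) ≤ K / (p : ℝ) ^ 2 := fun p hp => (h2526 p hp).2
  set G := sqConst A.density with hG
  have hG0 : 0 < G := sqConst_pos h24 h26
  have hparams : ∀ᶠ x : ℝ in atTop, 2 ≤ Real.log x ^ α ∧ 2 ≤ x ^ θ ∧ 2 ≤ P x ∧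
      P x ≤ (x ^ θ) ^ (1 / (2 ^ 35 * Real.log (Real.log x))) :=
    hpar.mono fun x hx => ⟨hx.2.2.1, le_trans hx.2.2.1 hx.2.2.2.1, hx.2.2.2.2.1, hx.2.2.2.2.2⟩
  have hH' : A.moebiusSq.HasDensityConstant (H / G) := A.hasDensityConstant_moebiusSq h24 h26 hH
  have hmain := fi_asymptotic_sieve_primes_roughWeak_loglog A.moebiusSq D P α θ (H / G) hα hθ hθ3
    hcore hparams hB hH'
  obtain ⟨Cm, hCm⟩ := hmain.bound
  have hA0 : ∀ x, 0 ≤ A.size x := fun x => by rw [hsize]; exact A.congrSum_nonneg 1 x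
  have hAle : ∀ x, A.moebiusSq.size x ≤ A.size x := fun x => by
    rw [hsize]; exact (A.moebiusSq_size_nonneg_le x).2
  refine IsBigO.of_bound ((max Cm 0 + 2) / G) ?_
  filter_upwards [hCm, hsz, eventually_ge_atTop (Real.exp (Real.exp 1))] with x hCmx hszx hxee
  -- basics
  have he1 : (1 : ℝ) < Real.exp 1 := by have := Real.exp_one_gt_d9; linarith
  have hx1 : 1 < x := lt_of_lt_of_le (by linarith [Real.exp_pos (Real.exp 1), Real.add_one_le_exp (Real.exp 1)]) hxee
  have hℒ1 : 1 ≤ Real.log x := by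
    rw [← Real.log_exp 1]
    exact Real.log_le_log (Real.exp_pos 1) (le_trans (Real.exp_le_exp.mpr he1.le) hxee)
  have hℒ0 : 0 < Real.log x := by linarith
  have hll1 : 1 ≤ Real.log (Real.log x) := by
    rw [← Real.log_exp 1]
    refine Real.log_le_log (Real.exp_pos 1) ?_
    rw [← Real.log_exp (Real.exp 1)]
    exact Real.log_le_log (Real.exp_pos _) hxee
  set ℓℓ := Real.log (Real.log x) / Real.log x with hℓℓ
  have hℓℓ0 : 0 ≤ ℓℓ := by positivity
  have hℓℓinv : 1 / Real.log x ≤ ℓℓ := div_le_div_of_nonneg_right hll1 hℒ0.le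
  have hAx := hA0 x
  have hÃ0 := (A.moebiusSq_size_nonneg_le x).1
  -- the two pieces
  rw [A.moebiusSq_primeSum] at hCmx
  rw [Real.norm_eq_abs, Real.norm_eq_abs] at hCmx ⊢
  have h1 : |∑ p ∈ Nat.primesLE ⌊x⌋₊, A.a p * Real.log p - H / G * A.moebiusSq.size x| ≤
      max Cm 0 / G * (|H| * A.size x * ℓℓ) := by
    refine hCmx.trans ?_
    rw [abs_mul, abs_mul, abs_div, abs_of_pos hG0, abs_of_nonneg hÃ0, abs_of_nonneg hℓℓ0]
    calc Cm * (|H| / G * A.moebiusSq.size x * ℓℓ) ≤ max Cm 0 * (|H| / G * A.moebiusSq.size x * ℓℓ) :=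
          mul_le_mul_of_nonneg_right (le_max_left _ _) (by positivity)
      _ ≤ max Cm 0 * (|H| / G * A.size x * ℓℓ) := by gcongr; exact hAle x
      _ = max Cm 0 / G * (|H| * A.size x * ℓℓ) := by ring
  have h2 : |H / G * A.moebiusSq.size x - H * A.size x| ≤ 2 / G * (|H| * A.size x * ℓℓ) := by
    have : H / G * A.moebiusSq.size x - H * A.size x = H / G * (A.moebiusSq.size x - G * A.size x) := by
      field_simp
    rw [this, abs_mul, abs_div, abs_of_pos hG0]
    calc |H| / G * |A.moebiusSq.size x - G * A.size x| ≤ |H| / G * (2 * A.size x / Real.log x) :=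
          mul_le_mul_of_nonneg_left hszx.2 (by positivity)
      _ = 2 / G * (|H| * A.size x * (1 / Real.log x)) := by ring
      _ ≤ 2 / G * (|H| * A.size x * ℓℓ) := by gcongr
  calc |∑ p ∈ Nat.primesLE ⌊x⌋₊, A.a p * Real.log p - H * A.size x|
      = |(∑ p ∈ Nat.primesLE ⌊x⌋₊, A.a p * Real.log p - H / G * A.moebiusSq.size x) +
          (H / G * A.moebiusSq.size x - H * A.size x)| := by ring_nf
    _ ≤ _ := abs_add_le _ _
    _ ≤ max Cm 0 / G * (|H| * A.size x * ℓℓ) + 2 / G * (|H| * A.size x * ℓℓ) := add_le_add h1 h2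
    _ = (max Cm 0 + 2) / G * |H * A.size x * ℓℓ| := by
        rw [abs_mul, abs_mul, abs_of_nonneg hAx, abs_of_nonneg hℓℓ0]; ring

end Literature.NumberTheory.Sieve
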